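import Summits.AtomisticToContinuum.HydrodynamicLimit.Theorems.CollisionIsometryCLTAdaptedWeightCLTBHDVTransferDV
import Summits.AtomisticToContinuum.HydrodynamicLimit.Theorems.CollisionIsometryCLTAdaptedWeightCLTBHDVTransferContact

/-!
# DV transfer for the line `block-h-dissipation-closure` (crux `AdaptedWeightCLT`, stmt-AtomisticToContinuum-14868),
# file 5: the Donsker–Varadhan step on the vocabulary of the line (per cell `x` and window `k`)

Support file (`--supports stmt-AtomisticToContinuum-14868`, anchor `bhDVTransfer_step_anchor`) of the line lead
`prover-line-stmt-AtomisticToContinuum-14868-c4-0`, written for the registered stub `stub_dvTransfer` (S2). It puts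
files 1, 3, 4 together on the actual objects of the line: for a window `k`, a location `x`, the window-start
configuration `w₀ = Φ_{kΔ} z`, the regularised cell law `f̂ = cellLaw N ψ h δ w₀ x`, `Λ = log f̂` and the
log-increment `ΔΛ(y) = Λ(y₃) + Λ(y₄) − Λ(y₁) − Λ(y₂)` of a contact quadruple `y = (v_a⁻, v_b⁻, v_a⁺, v_b⁺) ∈ Quad`:

* `klTerm_eq_zero_of_pairZ_eq_zero` — the JUNK CASE: if the atomic cell law at the window start has no pair flux
  (`pairZ = 0`: at most one atom, or all atoms at one velocity) then `chaosDens ≡ 0` and `klTerm = 0` by the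
  conventions `x / 0 = 0`, `log 0 = 0` (so `relEnt` does not see such cell-windows at all, although contacts may
  be charged to them: particles entering the cell during the window, or kernel-support-boundary contacts);
* `klTerm_nonneg` — off the junk case (`pairZ > 0`), on the good set, `klTerm = n · KL(p/n ‖ q) ≥ 0`
  (`p = contactDens`, `n = contactMass`, `q = chaosDens`; Gibbs), given integrability of `p log p`, `p log q`;
* `dv_step` — **the Donsker–Varadhan step**: off the junk case, on the good set, and given the four integrability
  side conditions (`p log p`, `p log q`, `ΔΛ p`, `e^{ΔΛ/2} q`),
  `n · (1 − ∫ e^{ΔΛ/2} q) − klTerm ≤ −½ ∫ ΔΛ · p`: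
  the contact mass times the smeared cross-Hellinger defect of the chaos reference, minus the relative entropy,
  bounds from below one half of the DV action of the realised contacts (TRIAGE-r1-3 Panel note A(5) with `t = ½`).
  By file 2 (`integral_fluxPair_exp_half_eq`) the defect `1 − ∫ e^{ΔΛ/2} q` would be EXACTLY `hellDiss f̂` if the
  pairs of `q` were drawn from `f̂ ⊗ f̂ B / Z(f̂)`; for the line's `chaosDens` (atomic pairs of `w₀`, smeared once) the
  two differ by the KDE/floor commutators — the inputs `(ii)` of the conditional transfer (file 6).

The four integrability side conditions hold for every good orbit (Gaussian-mixture bounds: `δ M ≤ f̂ ≤ (2πh²)^{-3/2}`,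
`|Λ(v)| ≤ A + |v − ū|²/(2h²)`, and `1/(4(θ̄ + h²)) < 1/(2h²)` for the exponential moment); they are kept as
hypotheses here and discharged separately. No definitions.
-/

namespace Summit.AtomisticToContinuum.HydrodynamicLimit.Theorems.BlockHDissipation

open scoped BigOperators Topology Classical MeasureTheory ENNReal InnerProductSpace
open Filter Set MeasureTheory Real
open Literature.Analysis.FluidPDE
open Summit.AtomisticToContinuum.HydrodynamicLimit.Theorems.ContactSourceDuhamel (T3 V3 Cfg Vel Flow Flows)
open Literature.MathematicalPhysics.KineticTheory (hsDiameter collide hardSphereKernel sphereMeasure)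

noncomputable section

namespace DVTransfer

variable {σ : ℝ} {N : ℕ}

/-- If the pair flux vanishes, the chaos reference is identically zero (junk convention `0⁻¹ = 0`). -/
theorem chaosDens_eq_zero_of_pairZ_eq_zero (ψ : ℕ → T3 → ℝ) (h : ℝ) (w : Cfg N) (x : T3)
    (hZ : pairZ N ψ w x = 0) (y : Quad) : chaosDens N ψ h w x y = 0 := by
  rw [chaosDens, hZ, inv_zero, zero_mul]

/-- **Junk case.** If the atomic cell law of the window-start configuration has no pair flux at `x`
(`pairZ = 0`), then `klTerm = 0` (conventions `x / 0 = 0`, `log 0 = 0`): the relative entropy-chaos functional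
does not see such cell-windows. -/
theorem klTerm_eq_zero_of_pairZ_eq_zero (Φ : Flow σ N) (ψ : ℕ → T3 → ℝ) (γc h t : ℝ) (z : Cfg N) (k : ℕ)
    (x : T3) (hZ : pairZ N ψ (Φ.flow ((k : ℝ) * winW γc N) z) x = 0) : klTerm σ N Φ ψ γc h t z k x = 0 := by
  unfold klTerm
  simp only [chaosDens_eq_zero_of_pairZ_eq_zero ψ h _ x hZ, mul_zero, div_zero, Real.log_zero, mul_zero,
    integral_zero]

/-- **`klTerm ≥ 0` off the junk case** (Gibbs' inequality): for a nonnegative kernel family, `h ≠ 0`, a good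
initial datum, a window `k` and a location `x` with `pairZ(Φ_{kΔ} z, x) > 0`, and integrable
`contactDens · log contactDens`, `contactDens · log chaosDens`, the relative entropy `klTerm = n · KL(p/n ‖ q)` is
nonnegative. -/
theorem klTerm_nonneg {ψ : ℕ → T3 → ℝ} (hψ : ∀ N y, 0 ≤ ψ N y) {h : ℝ} (hh : h ≠ 0) (Φ : Flow σ N) (γc t : ℝ)
    {z : Cfg N} (hz : z ∈ Φ.good) (k : ℕ) (x : T3) (hZ : 0 < pairZ N ψ (Φ.flow ((k : ℝ) * winW γc N) z) x)
    (i1 : Integrable fun y => contactDens σ N Φ ψ γc h t z k x y * Real.log (contactDens σ N Φ ψ γc h t z k x y))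
    (i2 : Integrable fun y => contactDens σ N Φ ψ γc h t z k x y *
      Real.log (chaosDens N ψ h (Φ.flow ((k : ℝ) * winW γc N) z) x y)) :
    0 ≤ klTerm σ N Φ ψ γc h t z k x := by
  have hfin := finite_collisionTimes_win Φ hz γc t k
  have key := klDens_nonneg (μ := (volume : Measure Quad))
    (Eventually.of_forall fun y => contactDens_nonneg hψ Φ γc hh t z k x hfin y)
    (Eventually.of_forall fun y => chaosDens_pos hψ hh N _ x hZ y) (integral_chaosDens hh N _ x hZ.ne')
    (integrable_contactDens Φ ψ γc hh t z k x hfin) i1 i2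
  rw [integral_contactDens Φ ψ γc hh t z k x hfin] at key
  exact key

/-- **The Donsker–Varadhan step on the line's objects.** Nonnegative kernel family, `h ≠ 0`, good initial datum,
window `k`, location `x` off the junk case (`pairZ(Φ_{kΔ} z, x) > 0`); `Λ = log cellLaw(Φ_{kΔ} z, x)`,
`ΔΛ(y) = Λ y₃ + Λ y₄ − Λ y₁ − Λ y₂`. Given the four integrability side conditions, 
`contactMass · (1 − ∫ e^{ΔΛ/2} chaosDens) − klTerm ≤ −∫ (ΔΛ/2) · contactDens`. -/
theorem dv_step {ψ : ℕ → T3 → ℝ} (hψ : ∀ N y, 0 ≤ ψ N y) {h : ℝ} (hh : h ≠ 0) (δ : ℝ) (Φ : Flow σ N) (γc t : ℝ)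
    {z : Cfg N} (hz : z ∈ Φ.good) (k : ℕ) (x : T3) (hZ : 0 < pairZ N ψ (Φ.flow ((k : ℝ) * winW γc N) z) x)
    (i1 : Integrable fun y => contactDens σ N Φ ψ γc h t z k x y * Real.log (contactDens σ N Φ ψ γc h t z k x y))
    (i2 : Integrable fun y => contactDens σ N Φ ψ γc h t z k x y *
      Real.log (chaosDens N ψ h (Φ.flow ((k : ℝ) * winW γc N) z) x y))
    (i3 : Integrable fun y : Quad =>
      2⁻¹ * (Real.log (cellLaw N ψ h δ (Φ.flow ((k : ℝ) * winW γc N) z) x y.2.2.1) +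
        Real.log (cellLaw N ψ h δ (Φ.flow ((k : ℝ) * winW γc N) z) x y.2.2.2) -
        Real.log (cellLaw N ψ h δ (Φ.flow ((k : ℝ) * winW γc N) z) x y.1) -
        Real.log (cellLaw N ψ h δ (Φ.flow ((k : ℝ) * winW γc N) z) x y.2.1)) * contactDens σ N Φ ψ γc h t z k x y)
    (i4 : Integrable fun y : Quad =>
      Real.exp (2⁻¹ * (Real.log (cellLaw N ψ h δ (Φ.flow ((k : ℝ) * winW γc N) z) x y.2.2.1) +
        Real.log (cellLaw N ψ h δ (Φ.flow ((k : ℝ) * winW γc N) z) x y.2.2.2) -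
        Real.log (cellLaw N ψ h δ (Φ.flow ((k : ℝ) * winW γc N) z) x y.1) -
        Real.log (cellLaw N ψ h δ (Φ.flow ((k : ℝ) * winW γc N) z) x y.2.1))) *
        chaosDens N ψ h (Φ.flow ((k : ℝ) * winW γc N) z) x y) :
    contactMass σ N Φ ψ γc t z k x *
        (1 - ∫ y : Quad, Real.exp (2⁻¹ * (Real.log (cellLaw N ψ h δ (Φ.flow ((k : ℝ) * winW γc N) z) x y.2.2.1) +
          Real.log (cellLaw N ψ h δ (Φ.flow ((k : ℝ) * winW γc N) z) x y.2.2.2) -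
          Real.log (cellLaw N ψ h δ (Φ.flow ((k : ℝ) * winW γc N) z) x y.1) -
          Real.log (cellLaw N ψ h δ (Φ.flow ((k : ℝ) * winW γc N) z) x y.2.1))) *
          chaosDens N ψ h (Φ.flow ((k : ℝ) * winW γc N) z) x y) -
      klTerm σ N Φ ψ γc h t z k x ≤
      -∫ y : Quad, 2⁻¹ * (Real.log (cellLaw N ψ h δ (Φ.flow ((k : ℝ) * winW γc N) z) x y.2.2.1) +
          Real.log (cellLaw N ψ h δ (Φ.flow ((k : ℝ) * winW γc N) z) x y.2.2.2) -
          Real.log (cellLaw N ψ h δ (Φ.flow ((k : ℝ) * winW γc N) z) x y.1) -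
          Real.log (cellLaw N ψ h δ (Φ.flow ((k : ℝ) * winW γc N) z) x y.2.1)) * contactDens σ N Φ ψ γc h t z k x y := by
  have hfin := finite_collisionTimes_win Φ hz γc t k
  have key := mul_one_sub_integral_exp_sub_klDens_le (μ := (volume : Measure Quad))
    (Eventually.of_forall fun y => contactDens_nonneg hψ Φ γc hh t z k x hfin y)
    (Eventually.of_forall fun y => chaosDens_pos hψ hh N _ x hZ y) (integral_chaosDens hh N _ x hZ.ne')
    (integrable_contactDens Φ ψ γc hh t z k x hfin) i1 i2 i3 i4
  rw [integral_contactDens Φ ψ γc hh t z k x hfin] at key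
  exact key

end DVTransfer

/-! ## Registered anchor of this support file -/

/-- ANCHOR (registered helper stub `bhDVTransfer_step_anchor` of the crux item): `klTerm ≥ 0` off the junk case —
for a nonnegative kernel family, `h ≠ 0`, a good initial datum and a (window, location) with positive window-start
pair flux, given integrable `contactDens log contactDens` and `contactDens log chaosDens`, the relative entropy
`klTerm = n KL(p/n ‖ q)` is nonnegative (Gibbs). -/
theorem bhDVTransfer_step_anchor : ∀ (σ : ℝ) (N : ℕ) (ψ : ℕ → T3 → ℝ), (∀ N y, 0 ≤ ψ N y) → ∀ (h : ℝ), h ≠ 0 → ∀ (Φ : Flow σ N) (γc t : ℝ) (z : Cfg N), z ∈ Φ.good → ∀ (k : ℕ) (x : T3), 0 < pairZ N ψ (Φ.flow ((k : ℝ) * winW γc N) z) x → MeasureTheory.Integrable (fun y => contactDens σ N Φ ψ γc h t z k x y * Real.log (contactDens σ N Φ ψ γc h t z k x y)) → MeasureTheory.Integrable (fun y => contactDens σ N Φ ψ γc h t z k x y * Real.log (chaosDens N ψ h (Φ.flow ((k : ℝ) * winW γc N) z) x y)) → 0 ≤ klTerm σ N Φ ψ γc h t z k x :=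
  fun _ _ _ hψ _ hh Φ γc t _ hz k x hZ i1 i2 => DVTransfer.klTerm_nonneg hψ hh Φ γc t hz k x hZ i1 i2

end

end Summit.AtomisticToContinuum.HydrodynamicLimit.Theorems.BlockHDissipation
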